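import Literature.IUT.HodgeArakelov.CohomologySystemOfContH1

/-!
# Restriction of the cohomology limit to a subgroup `D ≤ H` (Cor. 1.12 (ii) "restriction to `D ⊆ Π_Ÿ(Π)`")

Companion to `CohomologySystemOfContH1.lean` (the instantiation of the [IUTchII] Prop. 1.4 interface
`CohomologySystem` from L2's continuous `H¹`). S. Mochizuki, *Inter-universal Teichmüller theory II*, kurims
manuscript (Dec. 2020), Cor. 1.12 (ii) p. 57: "restriction to the subgroup `D ⊆ Π_Ÿ(Π)` determines [the
horizontal arrows in] a commutative diagram `{M^×_TM·∞θ(Π)}^ι → M^×_TM(Π) (⊆ lim_J H¹(J, (l·Δ_Θ)(Π)))`".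
The landed `ConstantMultipleRigidity.lean` (p410537) carries this restriction as the interface datum
`ThetaEvaluation.resD : lim_J H¹(Π_Ÿ(Π)|_J, ·) → Hd`. HERE, over the instantiated system: for subgroups
`D ≤ H` of `Π` the restriction maps `H¹(H ⊓ K, A) → H¹(D ⊓ K, A)` (`ContH1.res`), `K` finite-index open,
assemble into `h1LimRestrict : h1Lim φ A H J →+ h1Lim φ A D J` (DEFINED by the universal property), natural
in `J` (`h1LimRestrict_h1Res`) and computed on generators (`h1LimRestrict_of`); at `J = ⊥` this is the map
`lim_K H¹(H|_K, A) → lim_K H¹(D|_K, A)` of the printed diagram's shape. A construction over Mathlib + the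
landed files; nothing of [IUTchII] is asserted (claim key of the interface: `Mochizuki2012`, disputed).
-/

namespace Literature.IUT.HodgeArakelov

open Literature.AnabelianGeometry.EtaleTheta CohomologySystemOfContH1

universe u

noncomputable section

variable {P : TopGroup.{u}} {G' : Type u} [Group G'] [TopologicalSpace G'] [IsTopologicalGroup G']
  (φ : P →* G') (A : Subgroup G') [A.Normal] [IsMulCommutative A] {H D : Subgroup P} (hDH : D ≤ H)

/-- Restriction `H¹(H ⊓ K, A) → H¹(D ⊓ K, A)` on the members of the two systems at `J` (`D ≤ H`).
[cite: Mochizuki2012, Cor 1.12 (ii) p.57] -/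
def gmodRestrict (J : Subgroup P) (i : Idx (P := P) J) : Gmod φ A H J i →+ Gmod φ A D J i :=
  MonoidHom.toAdditive (ContH1.res φ A (inf_le_inf_right i.K hDH))

/-- The member-wise restrictions commute with the transition maps of the two systems.
[cite: Mochizuki2012, Cor 1.12 (ii) p.57] -/
theorem gmodRestrict_fmod (J : Subgroup P) {i j : Idx (P := P) J} (hij : i ≤ j) (x : Gmod φ A H J i) :
    gmodRestrict φ A hDH J j (fmod φ A H J i j hij x) = fmod φ A D J i j hij (gmodRestrict φ A hDH J i x) := by
  change Additive.ofMul (ContH1.res φ A _ (ContH1.res φ A _ (Additive.toMul x))) =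
    Additive.ofMul (ContH1.res φ A _ (ContH1.res φ A _ (Additive.toMul x)))
  rw [ContH1.res_res, ContH1.res_res]

/-- **Restriction of the limits** `h1Lim φ A H J → h1Lim φ A D J` for `D ≤ H` (DEFINED by the universal
property of the direct limit). [cite: Mochizuki2012, Cor 1.12 (ii) p.57] -/
def h1LimRestrict (J : Subgroup P) : h1Lim φ A H J →+ h1Lim φ A D J :=
  AddCommGroup.DirectLimit.lift (Gmod φ A H J) (fmod φ A H J) (h1Lim φ A D J)
    (fun i => (h1Of φ A D J i).comp (gmodRestrict φ A hDH J i))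
    (fun i j hij x => by
      change h1Of φ A D J j (gmodRestrict φ A hDH J j (fmod φ A H J i j hij x)) =
        h1Of φ A D J i (gmodRestrict φ A hDH J i x)
      rw [gmodRestrict_fmod, h1Of_fmod])

/-- `h1LimRestrict` on generators. [cite: Mochizuki2012, Cor 1.12 (ii) p.57] -/
@[simp] theorem h1LimRestrict_of (J : Subgroup P) (i : Idx (P := P) J) (x : Gmod φ A H J i) :
    h1LimRestrict φ A hDH J (h1Of φ A H J i x) = h1Of φ A D J i (gmodRestrict φ A hDH J i x) :=
  AddCommGroup.DirectLimit.lift_of (G := Gmod φ A H J) (f := fmod φ A H J) _ _ _ i x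

/-- NATURALITY in `J`: restriction of the limits commutes with the systems' maps `H1 J → H1 J'`.
[cite: Mochizuki2012, Cor 1.12 (ii) p.57] -/
theorem h1LimRestrict_h1Res {J J' : Subgroup P} (h : J' ≤ J) (x : h1Lim φ A H J) :
    h1LimRestrict φ A hDH J' (h1Res φ A H h x) = h1Res φ A D h (h1LimRestrict φ A hDH J x) := by
  have : (h1LimRestrict φ A hDH J').comp (h1Res φ A H h) =
      (h1Res φ A D h).comp (h1LimRestrict φ A hDH J) :=
    h1Lim_hom_ext φ A H fun i y => by
      change h1LimRestrict φ A hDH J' (h1Res φ A H h (h1Of φ A H J i y)) =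
        h1Res φ A D h (h1LimRestrict φ A hDH J (h1Of φ A H J i y))
      rw [h1Res_of, h1LimRestrict_of, h1LimRestrict_of, h1Res_of]
      rfl
  exact DFunLike.congr_fun this x

/-- In particular the restriction commutes with the maps to the limits (`toLim`) of the two instantiated
systems: the shape of the horizontal arrows of Cor. 1.12 (ii). [cite: Mochizuki2012, Cor 1.12 (ii) p.57] -/
theorem h1LimRestrict_toLim (J : Subgroup P) (x : h1Lim φ A H J) :
    h1LimRestrict φ A hDH ⊥ ((cohomologySystemOfContH1 φ A H).toLim J x) =
      (cohomologySystemOfContH1 φ A D).toLim J (h1LimRestrict φ A hDH J x) :=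
  h1LimRestrict_h1Res φ A hDH bot_le x

/-- Compatibility with the comparison isomorphisms at a finite-index open `J`: under
`H1 J ≅ H¹(H ⊓ J, A)` and `H1 J ≅ H¹(D ⊓ J, A)`, `h1LimRestrict` IS `ContH1.res` along `D ⊓ J ≤ H ⊓ J`.
[cite: Mochizuki2012, Cor 1.12 (ii) p.57] -/
theorem h1Equiv_h1LimRestrict (J : Subgroup P) (hJ : J.FiniteIndex) (hJo : IsOpen (J : Set P))
    (x : h1Lim φ A H J) :
    h1EquivOfFiniteIndexOpen φ A D J hJ hJo (h1LimRestrict φ A hDH J x) =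
      MonoidHom.toAdditive (ContH1.res φ A (inf_le_inf_right J hDH))
        (h1EquivOfFiniteIndexOpen φ A H J hJ hJo x) := by
  haveI := Idx.isDirected (P := P) J
  haveI : Nonempty (Idx (P := P) J) := ⟨Idx.top J⟩
  induction x using AddCommGroup.DirectLimit.induction_on with
  | ih i y =>
    change h1ToSelf φ A D J hJ hJo (h1LimRestrict φ A hDH J (h1Of φ A H J i y)) =
      MonoidHom.toAdditive (ContH1.res φ A (inf_le_inf_right J hDH)) (h1ToSelf φ A H J hJ hJo (h1Of φ A H J i y))
    rw [h1LimRestrict_of, h1ToSelf_of, h1ToSelf_of]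
    change Additive.ofMul (ContH1.res φ A _ (ContH1.res φ A _ (Additive.toMul y))) =
      Additive.ofMul (ContH1.res φ A _ (ContH1.res φ A _ (Additive.toMul y)))
    rw [ContH1.res_res, ContH1.res_res]

end

end Literature.IUT.HodgeArakelov
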